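import Summits.CriticalPhenomena.PercolationContinuityZ3.Theses.PercNonProliferation

/-! Crux-triage probe (refuter cruxtri r1-1): the crux elaborates; typed renderings of the
idea card `arm-mass-budget`'s transfer statements (my reconstruction from the evidence note:
ThinCrosserSparsity, ThinArmPricing) so that the `sharpen:` line of TRIAGE.md is a checked
signature. -/

open Literature.Probability.LatticeModels Literature.Probability.Percolation MeasureTheory
open scoped Classical

noncomputable section

namespace TriageProbe

theorem probe :
    Summit.CriticalPhenomena.PercolationContinuityZ3.Theses.PercNonProliferation.NonProliferation := by
  sorry

/-- critical measure on ℤ³ -/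
noncomputable abbrev μ : Measure (BondConfig (Site 3)) := bondPercolation (zdGraph 3) (criticalProbI 3)

/-- `x` is an arm point at scale `n`: joined inside `B(2n)` to the inner vertex boundary of `B(2n)`. -/
def armAt (n : ℕ) (x : Site 3) : Set (BondConfig (Site 3)) :=
  {ω | ∃ y ∈ innerBoundary (zdGraph 3) (box 3 (2 * n)), ω ∈ openConnIn ↑(box 3 (2 * n)) x y}

/-- in-box mass of the box-cluster of `x`: `|C_{B(2n)}(x) ∩ B(n)|` -/
noncomputable def massIn (n : ℕ) (ω : BondConfig (Site 3)) (x : Site 3) : ℕ :=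
  ((box 3 n).filter fun y => ω ∈ openConnIn ↑(box 3 (2 * n)) x y).card

/-- arm-mass budget `m_n = E #{x ∈ B(n) : x ↔ ∂⁻B(2n) in B(2n)}` -/
noncomputable def armBudget (n : ℕ) : ℝ := ∑ x ∈ box 3 n, μ.real (armAt n x)

/-- `k+1` pairwise-unjoined THIN spanning representatives (mass `< t·m_n`) exist -/
def thinReps (t : ℝ) (k n : ℕ) : Set (BondConfig (Site 3)) :=
  {ω | ∃ x : Fin (k + 1) → Site 3, (∀ i, x i ∈ box 3 n) ∧ (∀ i, ω ∈ armAt n (x i)) ∧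
    (∀ i j, i ≠ j → ω ∉ openConnIn ↑(box 3 (2 * n)) (x i) (x j)) ∧
    ∀ i, (massIn n ω (x i) : ℝ) < t * armBudget n}

/-- ThinCrosserSparsity (my typing): for some thinness level `t > 0`, with probability `≥ c`
there are at most `M` thin crossers, for infinitely many `n`. -/
def ThinCrosserSparsity : Prop :=
  ∃ (t : ℝ) (M : ℕ) (c : ℝ), 0 < t ∧ 0 < c ∧ ∃ᶠ n : ℕ in Filter.atTop, c ≤ μ.real (thinReps t M n)ᶜ

/-- ThinArmPricing, first-moment COUNT form (what the reduction actually needs):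
`E N_thin(t) = Σ_k P(N_thin(t) ≥ k+1) ≤ ε` for some `t = t(ε) > 0`, frequently in `n`. -/
def ThinArmPricing : Prop :=
  ∀ ε : ℝ, 0 < ε → ∃ t : ℝ, 0 < t ∧ ∃ᶠ n : ℕ in Filter.atTop,
    (∑ k ∈ Finset.range (box 3 n).card, μ.real (thinReps t k n)) ≤ ε

/-- Mesoscopic-MASS negligibility (the literal shape of Hutchcroft LR-II Prop II.5.3 transplanted
to crossers): the arm mass carried by thin crossers is `≤ ε m_n` in mean. This controls MASS, not
the NUMBER of thin crossers. -/
def ThinMassNegligible : Prop :=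
  ∀ ε : ℝ, 0 < ε → ∃ t : ℝ, 0 < t ∧ ∃ᶠ n : ℕ in Filter.atTop,
    (∫ ω, (((box 3 n).filter fun x => ω ∈ armAt n x ∧ (massIn n ω x : ℝ) < t * armBudget n).card : ℝ) ∂μ)
      ≤ ε * armBudget n

example : ThinCrosserSparsity := by sorry
example : ThinArmPricing := by sorry
example : ThinMassNegligible := by sorry

/-- Deterministic core of the lever (fat crossers are free, in EVERY dimension): pairwise-unjoined
representatives have pairwise-disjoint in-box clusters, so `#{fat reps} · (t m_n) ≤ #arm points in B(n)`.
Stated here at the level of the count only (signature check). -/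
example (t : ℝ) (k n : ℕ) (ω : BondConfig (Site 3)) (x : Fin (k + 1) → Site 3)
    (hx : ∀ i, x i ∈ box 3 n) (harm : ∀ i, ω ∈ armAt n (x i))
    (hdisj : ∀ i j, i ≠ j → ω ∉ openConnIn ↑(box 3 (2 * n)) (x i) (x j))
    (hfat : ∀ i, t * armBudget n ≤ (massIn n ω (x i) : ℝ)) :
    (k + 1 : ℝ) * (t * armBudget n) ≤ (((box 3 n).filter fun y => ω ∈ armAt n y).card : ℝ) := by
  sorry

end TriageProbe

end
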